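import Mathlib
import Summits.Ventures.PercRepro.PuncturedLYMLogConcave
import Summits.Ventures.PercRepro.PuncturedLYMSplitCount

/-!
# PercRepro — THE LEVEL COUNTS OF A PAIRWISE DISJOINT FAMILY ARE LOG-CONCAVE
(p10, gen 38)

For a family `𝒞` of pairwise disjoint members on the ground set `S`, the rows `r t = #rowsOf S t 𝒞` (the `t`-subsets of
`S` containing no member) form a log-concave sequence: `r i · r (j+1) ≤ r (i+1) · r j` for `i ≤ j` (`glc_rowsSeq`, in the
`ℤ`-indexed vocabulary `GLC` of PuncturedLYMLogConcave).  PROOF: adding a member `C` of size `m` convolves the counts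
of the rest (on `S ∖ C`) with the truncated binomial row `(C(m,0), …, C(m,m−1))` — a row `X` is `A ⊔ Z` with
`A = X ∩ C ⊊ C` and `Z = X ∖ C` a row of the rest (`rowsSeq_insert`) — and log-concavity is closed under convolution
(`glc_convSeq`); the base case is the binomial row of the free points (`glc_binRow`).  This is the log-concavity used
for the monotone fractions of the IFR lemma (PuncturedLYMIFR).  Nothing here asserts (SP).
-/

namespace PercRepro.PuncturedLYM.Split

open Finset LogConcave

variable {α : Type} [DecidableEq α]

/-- The binomial row `x ↦ C(n, x)` on `ℤ` (zero on the negatives). -/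
def binRow (n : ℕ) : ℤ → ℚ := fun x => if 0 ≤ x then ((n.choose x.toNat : ℕ) : ℚ) else 0

/-- The truncated binomial row `x ↦ C(m, x)` for `0 ≤ x < m`, zero elsewhere (the layers of a member of size `m`
that leave it incomplete). -/
def truncRow (m : ℕ) : ℤ → ℚ := fun x => if 0 ≤ x ∧ x < m then ((m.choose x.toNat : ℕ) : ℚ) else 0

/-- The level counts of a family, on `ℤ`. -/
def rowsSeq (S : Finset α) (𝒞 : Finset (Finset α)) : ℤ → ℚ :=
  fun n => if 0 ≤ n then ((rowsOf S n.toNat 𝒞).card : ℚ) else 0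

/-- Log-concavity of a binomial row, in `ℕ`: `C(n,i)·C(n,j+1) ≤ C(n,i+1)·C(n,j)` for `i ≤ j`. -/
theorem choose_glc (n i j : ℕ) (hij : i ≤ j) : n.choose i * n.choose (j + 1) ≤ n.choose (i + 1) * n.choose j := by
  have h1 := Nat.choose_succ_right_eq n j
  have h2 := Nat.choose_succ_right_eq n i
  have key : n.choose i * n.choose (j + 1) * ((i + 1) * (j + 1)) ≤ n.choose (i + 1) * n.choose j * ((i + 1) * (j + 1)) := by
    have e1 : n.choose i * n.choose (j + 1) * ((i + 1) * (j + 1)) = n.choose i * n.choose j * ((n - j) * (i + 1)) := by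
      calc n.choose i * n.choose (j + 1) * ((i + 1) * (j + 1))
          = n.choose i * (n.choose (j + 1) * (j + 1)) * (i + 1) := by ring
        _ = n.choose i * (n.choose j * (n - j)) * (i + 1) := by rw [h1]
        _ = n.choose i * n.choose j * ((n - j) * (i + 1)) := by ring
    have e2 : n.choose (i + 1) * n.choose j * ((i + 1) * (j + 1)) = n.choose i * n.choose j * ((n - i) * (j + 1)) := by
      calc n.choose (i + 1) * n.choose j * ((i + 1) * (j + 1))
          = (n.choose (i + 1) * (i + 1)) * n.choose j * (j + 1) := by ring
        _ = (n.choose i * (n - i)) * n.choose j * (j + 1) := by rw [h2]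
        _ = n.choose i * n.choose j * ((n - i) * (j + 1)) := by ring
    rw [e1, e2]
    apply Nat.mul_le_mul_left
    exact Nat.mul_le_mul (Nat.sub_le_sub_left hij n) (Nat.succ_le_succ hij)
  exact Nat.le_of_mul_le_mul_right key (by positivity)

/-- The binomial row is log-concave. -/
theorem glc_binRow (n : ℕ) : GLC (binRow n) where
  nonneg := by intro x; unfold binRow; split_ifs <;> positivity
  neg := by intro x hx; unfold binRow; rw [if_neg (by omega)]
  lc := by
    intro i j hij
    unfold binRow
    rcases lt_or_ge i 0 with hi | hi
    · rw [if_neg (by omega), zero_mul]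
      split_ifs <;> positivity
    · have hj : 0 ≤ j := le_trans hi hij
      rw [if_pos hi, if_pos (by omega), if_pos (by omega), if_pos hj]
      have e1 : (j + 1).toNat = j.toNat + 1 := by omega
      have e2 : (i + 1).toNat = i.toNat + 1 := by omega
      rw [e1, e2]
      exact_mod_cast choose_glc n i.toNat j.toNat (by omega)

/-- The truncated binomial row is log-concave. -/
theorem glc_truncRow (m : ℕ) : GLC (truncRow m) where
  nonneg := by intro x; unfold truncRow; split_ifs <;> positivity
  neg := by intro x hx; unfold truncRow; rw [if_neg (by omega)]
  lc := by
    intro i j hij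
    unfold truncRow
    rcases lt_or_ge i 0 with hi | hi
    · rw [if_neg (by omega), zero_mul]
      split_ifs <;> positivity
    · rcases lt_or_ge (j + 1) (m : ℤ) with hj1 | hj1
      · rw [if_pos ⟨hi, by omega⟩, if_pos ⟨by omega, hj1⟩, if_pos ⟨by omega, by omega⟩, if_pos ⟨by omega, by omega⟩]
        have e1 : (j + 1).toNat = j.toNat + 1 := by omega
        have e2 : (i + 1).toNat = i.toNat + 1 := by omega
        rw [e1, e2]
        exact_mod_cast choose_glc m i.toNat j.toNat (by omega)
      · rw [if_neg (show ¬ (0 ≤ j + 1 ∧ j + 1 < (m : ℤ)) from fun h => by omega), mul_zero]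
        split_ifs <;> positivity

/-- With no member, the rows are the whole level. -/
theorem rowsSeq_empty (S : Finset α) : rowsSeq S ∅ = binRow S.card := by
  funext n
  unfold rowsSeq binRow
  split_ifs with h
  · congr 1
    unfold rowsOf
    rw [filter_true_of_mem (fun X _ => by simp), card_powersetCard]
  · rfl

/-- The fibre of the rows of `insert C 𝒞` over `#(X ∖ C) = σ` is the product of the proper `(t−σ)`-subsets of `C`
and the rows of `𝒞` on `S ∖ C` at level `σ`. -/
theorem rows_insert_fiber_eq_image {S C : Finset α} {𝒞 : Finset (Finset α)} (hC : C ⊆ S)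
    (hdisj : ∀ C' ∈ 𝒞, Disjoint C' C) (t σ : ℕ) (hσ : σ ≤ t) :
    (rowsOf S t (insert C 𝒞)).filter (fun X => (X \ C).card = σ)
      = (((C.powersetCard (t - σ)).filter (fun A => A ≠ C)) ×ˢ rowsOf (S \ C) σ 𝒞).image
          (fun p => p.1 ∪ p.2) := by
  ext X
  rw [mem_filter, mem_rowsOf, mem_image]
  constructor
  · rintro ⟨⟨⟨hXS, hXc⟩, hav⟩, hXσ⟩
    refine ⟨(X ∩ C, X \ C), ?_, ?_⟩
    · rw [mem_product, mem_filter, mem_powersetCard, mem_rowsOf]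
      have hcard := card_sdiff_add_card_inter X C
      refine ⟨⟨⟨inter_subset_right, ?_⟩, ?_⟩, ⟨sdiff_subset_sdiff hXS (le_refl C), hXσ⟩, ?_⟩
      · show (X ∩ C).card = t - σ
        omega
      · intro h
        exact hav C (mem_insert_self C 𝒞) (by rw [← h]; exact inter_subset_left)
      · intro C' hC' hC'Z
        exact hav C' (mem_insert_of_mem hC') (hC'Z.trans sdiff_subset)
    · simp only
      rw [union_comm]
      exact sdiff_union_inter X C
  · rintro ⟨⟨A, Z⟩, hp, rfl⟩
    rw [mem_product, mem_filter, mem_powersetCard, mem_rowsOf] at hp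
    obtain ⟨⟨⟨hAC, hAc⟩, hAne⟩, ⟨hZS, hZc⟩, hZav⟩ := hp
    simp only
    have hAZ : Disjoint A Z := by
      apply Finset.disjoint_of_subset_left hAC
      apply Finset.disjoint_of_subset_right hZS
      exact disjoint_sdiff
    have hZC : Disjoint Z C := Finset.disjoint_of_subset_left hZS sdiff_disjoint
    have hsd : (A ∪ Z) \ C = Z := by
      rw [union_sdiff_distrib, sdiff_eq_empty_iff_subset.2 hAC, empty_union]
      exact sdiff_eq_self_of_disjoint hZC
    refine ⟨⟨⟨union_subset (hAC.trans hC) (hZS.trans sdiff_subset), ?_⟩, ?_⟩, ?_⟩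
    · rw [card_union_of_disjoint hAZ, hAc, hZc]; omega
    · intro C' hC'
      rw [mem_insert] at hC'
      rcases hC' with rfl | hC'
      · intro h
        apply hAne
        apply Subset.antisymm hAC
        intro x hx
        rcases mem_union.1 (h hx) with h1 | h1
        · exact h1
        · exact absurd hx (Finset.disjoint_left.1 hZC h1)
      · intro h
        apply hZav C' hC'
        intro x hx
        rcases mem_union.1 (h hx) with h1 | h1
        · exact absurd (hAC h1) (Finset.disjoint_left.1 (hdisj C' hC') hx)
        · exact h1
    · rw [hsd, hZc]

/-- The map `(A, Z) ↦ A ∪ Z` is injective on the product. -/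
theorem rows_insert_injOn {S C : Finset α} {𝒞 : Finset (Finset α)} (t σ : ℕ) :
    Set.InjOn (fun p : Finset α × Finset α => p.1 ∪ p.2)
      (((((C.powersetCard (t - σ)).filter (fun A => A ≠ C)) ×ˢ rowsOf (S \ C) σ 𝒞 :
        Finset (Finset α × Finset α)) : Set (Finset α × Finset α))) := by
  rintro ⟨A, Z⟩ hp ⟨A', Z'⟩ hp' h
  rw [mem_coe, mem_product, mem_filter, mem_powersetCard, mem_rowsOf] at hp hp'
  simp only at h
  have hAC : A ⊆ C := hp.1.1.1
  have hA'C : A' ⊆ C := hp'.1.1.1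
  have hZ : Z ⊆ S \ C := hp.2.1.1
  have hZ' : Z' ⊆ S \ C := hp'.2.1.1
  have hZC : Disjoint Z C := Finset.disjoint_of_subset_left hZ sdiff_disjoint
  have hZ'C : Disjoint Z' C := Finset.disjoint_of_subset_left hZ' sdiff_disjoint
  have e1 : (A ∪ Z) ∩ C = A := by
    rw [union_inter_distrib_right, inter_eq_left.2 hAC, (Finset.disjoint_iff_inter_eq_empty.1 hZC), union_empty]
  have e2 : (A' ∪ Z') ∩ C = A' := by
    rw [union_inter_distrib_right, inter_eq_left.2 hA'C, (Finset.disjoint_iff_inter_eq_empty.1 hZ'C), union_empty]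
  have e3 : (A ∪ Z) \ C = Z := by
    rw [union_sdiff_distrib, sdiff_eq_empty_iff_subset.2 hAC, empty_union]
    exact sdiff_eq_self_of_disjoint hZC
  have e4 : (A' ∪ Z') \ C = Z' := by
    rw [union_sdiff_distrib, sdiff_eq_empty_iff_subset.2 hA'C, empty_union]
    exact sdiff_eq_self_of_disjoint hZ'C
  have hA : A = A' := by rw [← e1, ← e2, h]
  have hZZ : Z = Z' := by rw [← e3, ← e4, h]
  rw [hA, hZZ]

/-- The proper `k`-subsets of a set of size `m` number `C(m, k)` for `k < m` and `0` otherwise. -/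
theorem card_filter_ne_powersetCard (C : Finset α) (k : ℕ) :
    ((((C.powersetCard k).filter (fun A => A ≠ C)).card : ℕ) : ℚ) = truncRow C.card k := by
  unfold truncRow
  rcases lt_or_ge k C.card with hk | hk
  · rw [if_pos ⟨by omega, by exact_mod_cast hk⟩]
    rw [filter_true_of_mem, card_powersetCard]
    · simp
    · intro A hA
      rw [mem_powersetCard] at hA
      rintro rfl
      omega
  · rw [if_neg (fun h => by omega)]
    rw [Nat.cast_eq_zero, card_eq_zero, filter_eq_empty_iff]
    intro A hA
    rw [mem_powersetCard] at hA
    intro hne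
    apply hne
    rcases eq_or_lt_of_le hk with h | h
    · exact eq_of_subset_of_card_le hA.1 (by omega)
    · exfalso
      have := card_le_card hA.1
      omega

/-- **The rows of `insert C 𝒞` are the convolution of the truncated binomial row of `C` with the rows of `𝒞` on
`S ∖ C`.** -/
theorem rowsSeq_insert {S C : Finset α} {𝒞 : Finset (Finset α)} (hC : C ⊆ S)
    (hdisj : ∀ C' ∈ 𝒞, Disjoint C' C) :
    rowsSeq S (insert C 𝒞) = convSeq (truncRow C.card) (rowsSeq (S \ C) 𝒞) := by
  funext n
  rcases lt_or_ge n 0 with hn | hn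
  · unfold rowsSeq convSeq
    rw [if_neg (by omega)]
    have : n.toNat = 0 := by omega
    rw [this]
    simp only [zero_add, range_one, sum_singleton, Nat.cast_zero, sub_zero]
    unfold truncRow
    rw [if_neg (fun h => by omega), zero_mul]
  · obtain ⟨t, rfl⟩ : ∃ t : ℕ, n = t := ⟨n.toNat, by omega⟩
    unfold rowsSeq convSeq
    rw [if_pos hn, Int.toNat_natCast]
    -- fiberwise by `σ = #(X ∖ C)`
    rw [card_eq_sum_card_fiberwise (f := fun X => (X \ C).card) (t := range (t + 1)) (by
      intro X hX
      rw [mem_coe, mem_rowsOf] at hX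
      simp only [mem_coe, mem_range]
      have := card_le_card (sdiff_subset : X \ C ⊆ X)
      omega)]
    push_cast
    apply sum_congr rfl
    intro σ hσ
    rw [mem_range] at hσ
    rw [rows_insert_fiber_eq_image hC hdisj t σ (by omega),
      card_image_of_injOn (rows_insert_injOn (S := S) (C := C) (𝒞 := 𝒞) t σ), card_product]
    push_cast
    rw [card_filter_ne_powersetCard C (t - σ)]
    rw [if_pos (by omega), Int.toNat_natCast]
    congr 1
    congr 1
    rw [Nat.cast_sub (by omega)]

/-- **THEOREM.** The level counts of a pairwise disjoint family on `S` are log-concave. -/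
theorem glc_rowsSeq (𝒞 : Finset (Finset α)) :
    ∀ S : Finset α, (∀ C ∈ 𝒞, C ⊆ S) → (∀ C ∈ 𝒞, ∀ C' ∈ 𝒞, C ≠ C' → Disjoint C C') → GLC (rowsSeq S 𝒞) := by
  induction 𝒞 using Finset.induction_on with
  | empty =>
    intro S _ _
    rw [rowsSeq_empty]
    exact glc_binRow S.card
  | insert C 𝒞 hC ih =>
    intro S hsub hpair
    have hCS : C ⊆ S := hsub C (mem_insert_self C 𝒞)
    have hdisj : ∀ C' ∈ 𝒞, Disjoint C' C := by
      intro C' hC'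
      exact hpair C' (mem_insert_of_mem hC') C (mem_insert_self C 𝒞) (fun h => hC (h ▸ hC'))
    rw [rowsSeq_insert hCS hdisj]
    apply glc_convSeq (glc_truncRow C.card)
    apply ih (S \ C)
    · intro C' hC'
      rw [subset_sdiff]
      exact ⟨hsub C' (mem_insert_of_mem hC'), hdisj C' hC'⟩
    · intro C₁ h₁ C₂ h₂ hne
      exact hpair C₁ (mem_insert_of_mem h₁) C₂ (mem_insert_of_mem h₂) hne

end PercRepro.PuncturedLYM.Split
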